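import Summits.Ventures.HSemireg.Pad4TowerUniverseDT1
import Summits.Ventures.HSemireg.Pad4TowerClassScreen

/-!
# Venture HSemireg — PAD-4: census entry 3 (U(D_T1) closed at first order, (F1ℝ) slice) FROM THE CLASS CONDITION (A1) —
# the Ψ-row hypothesis of `dt1_universe_closed` discharged by the kernel LEMMA Ψ ⊂ (A1) on light-cone cells

HONEST FRAMING. Lean index of the computation cell `pub-hsemireg` (S4-PUSH, H2 door PAD-4), typed by the Ventures-side typer
`hodge-lit-semireg-typer-2` (g4; line of record stmt-HodgeConjecture-18881 `Cruxes/BlochSeedDiscOne/Lines/birth.lean` 814a6a70c14e831a,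
stub `stub_rung_pad4_seedAt`, screen (H1); card row E3∕census entry 3 U(D_T1-universe) c94531e97af3470b). The assembly seat's kernel theorem
`Pad4TowerUniverseDT1.dt1_universe_closed` (hodge-semireg-assembly-p1 g0) carries the Ψ-ROW as a HYPOTHESIS (`psiSumC lower = psiSumC upper`)
— «Ψ's annihilation of ℚ[h] ⊕ W (PAD4-THEOREM-L (6.5), pencil ×2) … NOT IN LEAN» there. With the class frame of record now in the tree
(`Pad4TowerClassScreen`: the 6⁴-word frame, the class screen (A1) `ClassScreen`, `lamTwelve = 12Λ`, `lamTwelve_eq_zero_of_classScreen`,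
`lamTwelve_chTensor_phiVec`), THIS FILE restates that theorem with the Ψ-row REPLACED BY THE CLASS CONDITION (A1) of PAD4-FIRSTORDER §0
on the (F1ℝ) light-cone designs of `Pad4TowerLemmaT` ∕ `Pad4TowerUniverseDT1` (lists of cells `Cell = Fin 4 → Fin 2 → ℕ`, multiplicity by
repetition): the class tensor of a light-cone cell (`α_f = a_f + b_f`, REAL `β_f = a_f − b_f`, `p_f = α_f² − β_f² = 4 a_f b_f`), its
`eeee`-coefficient `= muTermC` (so `muC` is the `W`-coordinate of the design's tensor, as FILE A's `mu` is in `Pad4TowerPsiSubA1`), and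
`Λ₁₂(ch Z) = 12·Cell.psi Z`; hence (A1) ⇒ `psiSumC lower = psiSumC upper` ⇒ `dt1_universe_closed` from (A1) + (H1) + G-invariance.

CONTENT (all PROVED; no `sorry`; axioms standard). `Cell.ch` (class tensor over `ℤ`), `Cell.ch_eWord` (`= muTermC`), `Cell.lamTwelve_ch`
(`Λ₁₂(ch Z) = 12 Ψ(Z)` cast), `designChC` (`Σ_N ch − Σ_P ch`), `designChC_eWord` (`= muC`), **`ClassConditionC lower upper := ClassScreen
(designChC lower upper)`**, **`psiSumC_eq_of_classConditionC`** ((A1) ⇒ Ψ-row), **`dt1_squeeze_of_classCondition`** and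
**`dt1_universe_closed_of_classCondition`** (census entry 3's kernel theorem with hypotheses (A1), (H1) `muC ≠ 0`, `GInvariant` — the Ψ-row
no longer assumed).

WHAT IS NOT HERE ∕ NOT IN LEAN. As in `Pad4TowerClassScreen`: the identification of the frame with `H^{ev}(S⁴)` and of `ℚ[h] ⊕ W` with the
(A1)-target (the cell's modelling sentence, pencil ×2); everything `Pad4TowerUniverseDT1` lists as not in Lean other than the Ψ-row (the
(E1)-meaning of `A2IDead`, the μ₄ phases). No variety, sheaf, σ, seed or abelian variety; NOTHING HERE SAYS THAT HC ∕ HC_CM ∕ HC_AV ∕ W₆ ∕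
HC_Kum4Type HOLDS OR FAILS. No `instance`, no notation, no named fact, 0 `sorry`.

SOURCES (sha16): `Pad4TowerUniverseDT1.lean` (tree; assembly-p1 g0; census words c94531e97af3470b), `Pad4TowerClassScreen.lean` 1ffb82cfe6f0a1dc
(p591160, this typer), `Pad4TowerPsi.lean` b23c6bbb35c2be0c (`psiLC`); PAD4-THEOREM-L-search-1.md 7011a711a54d33d2 (6.5).
-/

namespace Summit.Ventures.HSemireg.Pad4Tower

open Finset

/-! ## §1 The class tensor of a light-cone cell -/

/-- the CLASS TENSOR of an (F1ℝ) light-cone cell: per factor the balanced letter vector `(1, α, α, β, β, α² − β²)` with `α = a + b`,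
REAL `β = a − b` (so `β̄ = β`), `p = α² − β² = 4ab`; integer coefficients. -/
def Cell.ch (Z : Cell) : CWord → ℤ :=
  chTensor fun f => phiVec ((Z f 0 : ℤ) + Z f 1) ((Z f 0 : ℤ) - Z f 1) ((Z f 0 : ℤ) - Z f 1)
    (((Z f 0 : ℤ) + Z f 1) ^ 2 - ((Z f 0 : ℤ) - Z f 1) ^ 2)

/-- **the `eeee`-coefficient of a cell IS `muTermC = Π_f (a_f − b_f)`.** -/
theorem Cell.ch_eWord (Z : Cell) : Z.ch eWord = muTermC Z := by
  simp only [Cell.ch, chTensor, phiVec, eWord, muTermC, Fin.prod_univ_four]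
  simp only [Matrix.cons_val]

/-- **`Λ₁₂(ch Z) = 12 Ψ(Z)`** on light-cone cells (`Cell.psi = psiLC`: `α = a + b`, `s = (a − b)² = α² − p`). -/
theorem Cell.lamTwelve_ch (Z : Cell) : ((lamTwelve Z.ch : ℤ) : ℚ) = 12 * Z.psi := by
  rw [Cell.ch, lamTwelve_chTensor_phiVec, show ((psiTwelve _ _ : ℤ) : ℚ) = Int.castRingHom ℚ (psiTwelve _ _) from rfl,
    map_psiTwelve, Cell.psi, psiLC, psiForm]
  simp only [psiTwelve, pairTerm, eq_intCast, Int.cast_sub, Int.cast_pow, Int.cast_add, Int.cast_natCast]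
  ring

/-! ## §2 Designs as cell lists: the class condition and the Ψ-row -/

/-- the class tensor of a two-level (F1ℝ) design given by its constituent lists: `Σ_N ch(N) − Σ_P ch(P)` (multiplicity by repetition). -/
def designChC (lower upper : List Cell) : CWord → ℤ := (lower.map Cell.ch).sum - (upper.map Cell.ch).sum

/-- **the `eeee`-coefficient of the design's tensor IS the μ-word `muC`** (so (H1) `muC ≠ 0` is the `W`-coordinate statement). -/
theorem designChC_eWord (lower upper : List Cell) : designChC lower upper eWord = muC lower upper := by
  simp only [designChC, muC, Pi.sub_apply, Pi.list_sum_apply, List.map_map, Function.comp_def, Cell.ch_eWord]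

/-- **THE CLASS CONDITION (A1)** of an (F1ℝ) design (PAD4-FIRSTORDER §0 (H1): `ch(E) ∈ ℚ[h] ⊕ W`, in the frame of record). -/
def ClassConditionC (lower upper : List Cell) : Prop := ClassScreen (designChC lower upper)

/-- **(A1) ⇒ THE Ψ-ROW** on (F1ℝ) designs: `psiSumC lower = psiSumC upper`. -/
theorem psiSumC_eq_of_classConditionC (lower upper : List Cell) (h : ClassConditionC lower upper) :
    psiSumC lower = psiSumC upper := by
  have h0 := lamTwelve_eq_zero_of_classScreen _ h
  rw [designChC, map_sub, map_list_sum, map_list_sum, List.map_map, List.map_map] at h0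
  have h1 : (((lower.map (⇑(lamTwelve (R := ℤ)) ∘ Cell.ch)).sum - (upper.map (⇑(lamTwelve (R := ℤ)) ∘ Cell.ch)).sum : ℤ) : ℚ)
      = 0 := by
    rw [h0, Int.cast_zero]
  push_cast [List.map_map, Function.comp_def, Cell.lamTwelve_ch] at h1
  have hl : ∀ l : List Cell, (l.map fun X => (12 : ℚ) * X.psi).sum = 12 * psiSumC l := fun l => by
    rw [psiSumC, List.sum_map_mul_left]
  rw [hl, hl] at h1
  linarith

/-! ## §3 Census entry 3 from (A1) -/

/-- the squeeze of `Pad4TowerUniverseDT1` with the Ψ-row supplied by (A1). -/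
theorem dt1_squeeze_of_classCondition (lower upper : List Cell) (hN : ∀ Z ∈ lower, InDT1N Z) (hP : ∀ P ∈ upper, InDT1P P)
    (h1 : muC lower upper ≠ 0) (hA1 : ClassConditionC lower upper) : ∃ Z ∈ lower, Z.key ∈ speciesKeys :=
  dt1_squeeze lower upper hN hP h1 (psiSumC_eq_of_classConditionC lower upper hA1)

/-- **CENSUS ENTRY 3 (U(D_T1) closed at first order, (F1ℝ) slice) FROM (A1) + (H1) + G-INVARIANCE**: every G-invariant two-level
design in the universe U(D_T1)^ℝ whose class tensor passes the class screen (A1) and whose μ-word is non-zero (H1) contains an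
`N`-constituent of a tower species satisfying the LEMMA-A∪2I′ clean-form kill predicate — `dt1_universe_closed` with its Ψ-row
hypothesis discharged. -/
theorem dt1_universe_closed_of_classCondition (lower upper : List Cell) (hN : ∀ Z ∈ lower, InDT1N Z)
    (hP : ∀ P ∈ upper, InDT1P P) (h1 : muC lower upper ≠ 0) (hA1 : ClassConditionC lower upper)
    (hG : GInvariant lower.toFinset) :
    ∃ Z ∈ lower, Z.key ∈ speciesKeys ∧ ∃ σ f'' : Fin 4, A2IDead ⟨lower.toFinset, upper.toFinset⟩ Z σ f'' :=
  dt1_universe_closed lower upper hN hP h1 (psiSumC_eq_of_classConditionC lower upper hA1) hG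

end Summit.Ventures.HSemireg.Pad4Tower
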